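import Literature.AlgebraicGeometry.Frobenioids.PadicKummerThm24iInstances
import Literature.AlgebraicGeometry.Frobenioids.PadicKummerThm24iGalois
import HarnessLib

/-!
# Frobenioids II, Theorem 2.4 (i): a CLOSED non-vacuity certificate for the typed theorem at the binding

Mochizuki, *The geometry of Frobenioids II*, Kyushu J. Math. **62** (2008) 401–460, §2, Theorem 2.4 (i)
pp. 19–20 with Remark 2.2.1 p. 18 ("there exists a pull-back morphism `A″ → A′` in `C` such that `A″`
is `(N, H)`-saturated") and Remark 2.4.1 p. 22 [cite: MochizukiFrdII2008, Thm 2.4 (i) p.19].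

PROOF-ONLY file (seat abc-iut-L1-t7, gen 4; cell row W12). The typed Theorem 2.4 (i)
(`PadicKummer.Thm24i`) has now been proved at the arithmetic binding along every context isomorphism
modulo `hfs` (abc-iut-L2-t12 `Iso.thm24i_ofLocalField`, abc-iut-L1-t7 `thm24i_ofGalois` /
`thm24i_of_isoGalois`) and UNCONDITIONALLY along the conjugation by `g ∈ G_K` (abc-iut-L1-d4
`thm24i_conj_ofLocalField`) — each for a GIVEN `(N, H)`-saturated object. This file records the closed
form obtained by combining the latter with Remark 2.2.1 in its cofinal form (abc-iut-L1-t7 g3's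
`exists_saturated_kummerHypotheses_ofLocalField`): **from the bare data "`K ⊇ ℚ_p` finite, `H ⊆ G_K`
open normal, `N ≥ 1`, `g ∈ G_K`" and NO further hypothesis**, above every finite `L′ ⊆ K̄` there is a
finite Galois `L` and `O^□_L` such that the object `A = (L, O^□_L)` is `(N, H)`-saturated, `θ` and the
adjoint cup product are bijective (so the duality isomorphism of Definition 2.2 (ii) is the CONSTRUCTED
one), and the typed Theorem 2.4 (i) HOLDS for the comparison data of the conjugation by `g` — a
kernel certificate that the hypotheses of the W12 chain are jointly satisfiable and the assembled
statement is inhabited with all data constructed (the non-archimedean local field structure of `K` is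
DERIVED from `K ⊇ ℚ_p`: `FiniteExtension.isNonarchimedeanLocalField`, `Padic.isNonarchimedeanLocalField_holds`).
Nothing here concerns [IUTchIII]; classical; universe `0`.
-/

noncomputable section

namespace Literature.AlgebraicGeometry.Frobenioids

namespace PadicKummer

namespace Def22Context

open Field IntermediateField Kummer
open Literature.NumberTheory.GaloisRepresentations
open Literature.NumberTheory.GaloisRepresentations.LocalWeilDatum
open Literature.AnabelianGeometry.AbsoluteAnabelian

/-- **Theorem 2.4 (i) is inhabited, cofinally, with all data constructed and no residual hypothesis.**
For a finite extension `K ⊇ ℚ_p`, an open normal `H ⊆ G_K`, `N ≥ 1`, `g ∈ G_K`, either reading `fs` of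
"`Φ` fieldwise saturated" (selecting `O^□ = O^⊳` or `O^×`, Def. 2.2 (iii)) and any finite `L′ ⊆ K̄`:
there is a finite Galois `L ⊇ L′` such that the arithmetic object `A = (L, O^□_L)`
(`ofLocalField L H … (boxStableSubmonoid K L fs)`) is `(N, H)`-saturated (Rmk. 2.2.1), `θ` and the
adjoint cup product of Def. 2.2 (ii) are bijective, and the typed `Thm24i` holds for the comparison
data of the context automorphism "conjugation by `g`" (Def. 2.2 (i) / Rmk. 2.4.1) and the cup-product
duality isomorphism. [cite: MochizukiFrdII2008, Thm 2.4 (i) p.19] -/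
theorem exists_thm24i_conj (p : ℕ) [Fact p.Prime] (K : Type) [Field K] [Algebra ℚ_[p] K]
    [FiniteDimensional ℚ_[p] K] (H : Subgroup (absoluteGaloisGroup K)) [H.Normal]
    (hH : IsOpen (H : Set (absoluteGaloisGroup K))) (N : ℕ) [NeZero N] (g : absoluteGaloisGroup K)
    (fs : Prop) (L' : IntermediateField K (AlgebraicClosure K)) [FiniteDimensional K L'] :
    ∃ (L : IntermediateField K (AlgebraicClosure K)) (_ : FiniteDimensional K L) (_ : Normal K L)
      (S : StableSubmonoid L), L' ≤ L ∧ IsGalois K L ∧ galFixing K L ≤ H ∧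
      ∃ (_ : IsNHSaturated (ofLocalField L H hH S) N)
        (hθ : Function.Bijective (thetaHomOf (ofLocalField L H hH S) N))
        (hcup : Function.Bijective (cupDualOf (ofLocalField L H hH S) N)),
        Thm24i (ofLocalField L H hH S) (ofLocalField L H hH S) N p p fs fs
          ((Iso.conjOfGaloisQuot L H hH (GalMonoid S) g).thm24Data N)
          (dualityIsoOfBijective (ofLocalField L H hH S) N hθ hcup)
          (dualityIsoOfBijective (ofLocalField L H hH S) N hθ hcup) := by
  haveI : IsNonarchimedeanLocalField ℚ_[p] := Padic.isNonarchimedeanLocalField_holds p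
  letI := FiniteExtension.valuativeRel ℚ_[p] K
  letI := FiniteExtension.topologicalSpace ℚ_[p] K
  haveI : IsNonarchimedeanLocalField K := FiniteExtension.isNonarchimedeanLocalField ℚ_[p] K
  haveI : CharZero K := charZero_of_injective_algebraMap (algebraMap ℚ_[p] K).injective
  obtain ⟨L, hfin, hgal, hle, hHL, hsat, -, -, -⟩ :=
    exists_saturated_kummerHypotheses_ofLocalField L' H hH N fs
  haveI := hfin
  haveI := hgal
  have hS : ∀ x : L, x ^ N = 1 → x ∈ (boxStableSubmonoid K L fs).toSubmonoid := fun x hx =>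
    mem_boxStableSubmonoid_of_pow_eq_one K L N fs (NeZero.pos N) hx
  exact ⟨L, hfin, inferInstance, boxStableSubmonoid K L fs, hle, hgal, hHL, hsat,
    thetaHom_bijective_ofLocalField L H hH _ N hS hsat, cupDual_bijective_ofLocalField L H hH _ N hS hsat,
    thm24i_conj_ofLocalField L H hH (boxStableSubmonoid K L fs) N g fs hS hsat⟩

end Def22Context

end PadicKummer

end Literature.AlgebraicGeometry.Frobenioids

end
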